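import Summits.RiemannHypothesis.RiemannHypothesis.Theses.WeilComb
import Summits.RiemannHypothesis.RiemannHypothesis.Theorems.WeilCombCombShapeAdmissible
import Summits.RiemannHypothesis.RiemannHypothesis.Theorems.CombShapePositivity.Negative.WeilCombCombShapePositivityLoadBearing
import Literature.NumberTheory.LFunctions.WeilExplicit
import Literature.NumberTheory.LFunctions.WeilMellinBounds

/-!
# Mellin factorisation of the fixed-shape comb on the critical line
(crux `WeilComb.CombShapePositivity`, item stmt-RiemannHypothesis-11229, line `Sketch`; stub `stub_windowMellin`
(W1) of the glued Theorem-B statement `stub_window`)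

Notation: `φ₀(u) = expNegInvGlue (1 - u²)` (the route's fixed bump, a Weil test by
`weilComb_shapeBump_isWeilTest`), `φ_ε(t) = ε⁻¹ φ₀(t/ε)`, comb `g(x) = Σ_{1 ≤ m ≤ M} a_m φ_ε(x − log m)`,
`ĥ = weilMellin h`, `ĥ(s) = ∫ h(t) e^{(s − 1/2) t} dt`, Dirichlet polynomial `D_a(t) = Σ_{m ≤ M} a_m e^{it log m}`.

**Statement.** For `ε > 0`, `M`, `a`, `t`:
`ĝ(1/2 + it) = D_a(t) · φ̂_ε(1/2 + it)`.

**Proof.** Each node of the comb is the translate `τ_{log m} φ_ε = φ_ε(· − log m)` (`weilTranslate`); by the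
translation rule `(τ_x h)^(s) = e^{(s − 1/2) x} ĥ(s)` (`weilMellin_weilTranslate`) and linearity of the transform
over the finite sum (`integral_finsetSum`, each summand integrable as the Weil integrand of a test function,
`integrable_weilIntegrand`), `ĝ(s) = (Σ_m a_m e^{(s − 1/2) log m}) φ̂_ε(s)` for every `s`; at `s = 1/2 + it` the
exponent is `it log m`.
-/

noncomputable section

-- the sub-problem path RiemannHypothesis/RiemannHypothesis duplicates a namespace (D-0017)
set_option linter.dupNamespace false

open scoped BigOperators ComplexConjugate
open Complex MeasureTheory

namespace Summit.RiemannHypothesis.RiemannHypothesis.Theorems.WeilCombBohrFejer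

open Literature.NumberTheory.LFunctions

/-! ### Private toolkit: the dilate `φ_ε` and the transform of a comb -/

/-- `φ_ε = ε⁻¹ φ(·/ε)` is a Weil test function for `ε ≠ 0` (smoothness of `t ↦ t/ε`; the support is
the image of a compact set under the homeomorphism `t ↦ ε t`). [folklore] -/
private theorem isWeilTest_dil_windowMellin {φ : ℝ → ℂ} {ε : ℝ} (hφ : IsWeilTest φ) (hε : ε ≠ 0) :
    IsWeilTest (fun t : ℝ => (ε : ℂ)⁻¹ * φ (t / ε)) := by
  -- adapted from `WeilCombBohrFejer.isWeilTest_dil_polarExact` (private in the polar-term file)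
  have h1 : IsWeilTest (fun t : ℝ => φ (t / ε)) := by
    refine ⟨hφ.1.comp (contDiff_id.div_const ε), ?_⟩
    have e : (fun t : ℝ => φ (t / ε)) = φ ∘ (Homeomorph.mulRight₀ ε⁻¹ (inv_ne_zero hε)) := by
      ext t
      simp [div_eq_mul_inv]
    rw [e]
    exact hφ.2.comp_homeomorph _
  exact h1.const_mul _

/-- Transform of a comb built on a Weil test `φ`: `ĝ(s) = (Σ_m a_m e^{(s − 1/2) log m}) φ̂_ε(s)`
(linearity over the finite sum, `integral_finsetSum`, and the translation rule
`weilMellin_weilTranslate`). [folklore] -/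
private theorem weilMellin_comb_windowMellin {φ : ℝ → ℂ} (hφ : IsWeilTest φ) {ε : ℝ} (hε : ε ≠ 0)
    (M : ℕ) (a : ℕ → ℂ) (s : ℂ) :
    weilMellin (fun x : ℝ => ∑ m ∈ Finset.Icc 1 M,
        a m * ((ε : ℂ)⁻¹ * φ ((x - Real.log (m : ℝ)) / ε))) s =
      (∑ m ∈ Finset.Icc 1 M, a m * cexp ((s - 1 / 2) * (Real.log (m : ℝ) : ℂ))) *
        weilMellin (fun t : ℝ => (ε : ℂ)⁻¹ * φ (t / ε)) s := by
  -- adapted from `WeilCombBohrFejer.weilMellin_comb_polarExact` (private in the polar-term file)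
  set φε : ℝ → ℂ := fun t : ℝ => (ε : ℂ)⁻¹ * φ (t / ε) with hφε
  have hW : IsWeilTest φε := isWeilTest_dil_windowMellin hφ hε
  have hint : ∀ m ∈ Finset.Icc 1 M, Integrable (fun t : ℝ =>
      a m * (weilTranslate φε (Real.log (m : ℝ)) t * cexp ((s - 1 / 2) * t))) := by
    intro m _
    have hT : IsWeilTest (weilTranslate φε (Real.log (m : ℝ))) := hW.weilTranslate _
    exact (integrable_weilIntegrand hT.1.continuous hT.2 s).const_mul (a m)
  calc weilMellin (fun x : ℝ => ∑ m ∈ Finset.Icc 1 M,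
          a m * ((ε : ℂ)⁻¹ * φ ((x - Real.log (m : ℝ)) / ε))) s
      = ∫ t : ℝ, ∑ m ∈ Finset.Icc 1 M,
          a m * (weilTranslate φε (Real.log (m : ℝ)) t * cexp ((s - 1 / 2) * t)) := by
        unfold weilMellin
        congr 1 with t
        rw [Finset.sum_mul]
        refine Finset.sum_congr rfl fun m _ => ?_
        simp only [weilTranslate, hφε]
        ring
    _ = ∑ m ∈ Finset.Icc 1 M, ∫ t : ℝ,
          a m * (weilTranslate φε (Real.log (m : ℝ)) t * cexp ((s - 1 / 2) * t)) :=
        integral_finsetSum _ hint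
    _ = ∑ m ∈ Finset.Icc 1 M,
          a m * (cexp ((s - 1 / 2) * (Real.log (m : ℝ) : ℂ)) * weilMellin φε s) := by
        refine Finset.sum_congr rfl fun m _ => ?_
        rw [integral_const_mul, ← weilMellin_weilTranslate]
        rfl
    _ = (∑ m ∈ Finset.Icc 1 M, a m * cexp ((s - 1 / 2) * (Real.log (m : ℝ) : ℂ))) *
          weilMellin φε s := by
        rw [Finset.sum_mul]
        refine Finset.sum_congr rfl fun m _ => ?_
        ring

/-- Transform of the fixed-shape comb: `ĝ(s) = (Σ_m a_m e^{(s − 1/2) log m}) φ̂_ε(s)` (`ε ≠ 0`). [folklore] -/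
private theorem weilMellin_shapeComb_windowMellin {ε : ℝ} (hε : ε ≠ 0) (M : ℕ) (a : ℕ → ℂ) (s : ℂ) :
    weilMellin (fun x : ℝ => ∑ m ∈ Finset.Icc 1 M,
        a m * ((ε : ℂ)⁻¹ * ((expNegInvGlue (1 - ((x - Real.log (m : ℝ)) / ε) ^ 2) : ℝ) : ℂ))) s =
      (∑ m ∈ Finset.Icc 1 M, a m * cexp ((s - 1 / 2) * (Real.log (m : ℝ) : ℂ))) *
        weilMellin (fun t : ℝ => (ε : ℂ)⁻¹ * ((expNegInvGlue (1 - (t / ε) ^ 2) : ℝ) : ℂ)) s :=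
  -- adapted from `WeilCombBohrFejer.weilMellin_shapeComb_polarExact` (private in the polar-term file)
  weilMellin_comb_windowMellin (φ := fun u : ℝ => ((expNegInvGlue (1 - u ^ 2) : ℝ) : ℂ))
    Summit.RiemannHypothesis.RiemannHypothesis.Theorems.weilComb_shapeBump_isWeilTest hε M a s

/-! ### The stub -/

/-- **Stub W1 — Mellin factorisation of the comb on the critical line** (stub `stub_windowMellin` of the
glued Theorem-B statement `stub_window`, line `Sketch`). For `ε > 0`, `M`, `a`, `t`:
`ĝ(1/2 + it) = D_a(t) · φ̂_ε(1/2 + it)` with `D_a(t) = Σ_{m ≤ M} a_m e^{it log m}` (each node is the translate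
`τ_{log m} φ_ε`, `weilMellin_weilTranslate`, and `weilMellin` is linear over the finite sum). [folklore] -/
theorem stub_windowMellin : ∀ ε : ℝ, 0 < ε → ∀ (M : ℕ) (a : ℕ → ℂ) (t : ℝ),
    weilMellin (fun x : ℝ => ∑ m ∈ Finset.Icc 1 M,
        a m * ((ε : ℂ)⁻¹ * ((expNegInvGlue (1 - ((x - Real.log (m : ℝ)) / ε) ^ 2) : ℝ) : ℂ)))
      (1 / 2 + t * I) =
      (∑ m ∈ Finset.Icc 1 M, a m * cexp (t * I * (Real.log (m : ℝ) : ℂ))) *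
        weilMellin (fun t : ℝ => (ε : ℂ)⁻¹ * ((expNegInvGlue (1 - (t / ε) ^ 2) : ℝ) : ℂ))
          (1 / 2 + t * I) := by
  intro ε hε M a t
  rw [weilMellin_shapeComb_windowMellin hε.ne' M a (1 / 2 + t * I), add_sub_cancel_left]

end Summit.RiemannHypothesis.RiemannHypothesis.Theorems.WeilCombBohrFejer

end
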